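import Literature.NumberTheory.Automorphic.GL2EllipticCompactSupport
import Literature.NumberTheory.Automorphic.GL2ParabolicClasses
import Literature.Topology.Algebra.InfiniteSum.WeightedTransfer
import HarnessLib

/-!
# The parabolic part of the kernel for `GL₂` as a weighted sum over `GL₂(K) ⧸ B(K)`
(Gelbart, *Automorphic forms on adele groups* (1975), (9.36)–(9.39), p. 126; Jacquet–Langlands
(1970), §16)

Topic `NumberTheory/Automorphic`; theorems only (no definition, no named fact, no instance visible
to importers). In `GL2TraceFormulaModParabolic` the trace formula for `GL₂` (supercusp-type test
functions) is proved modulo the integral over `X = GL₂(𝔸_K) ⧸ ℝ_{>0} GL₂(K)` of the **parabolic kernel**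
`K_par(x̃) = Σ_{γ ∈ S_P} Ψ_A(x̃ γ x̃⁻¹)`, `S_P =` the rational elements that are neither central nor
elliptic regular. Its evaluation (Gelbart §9.B) starts from the rearrangement (9.36)–(9.38) of this
sum as a sum over `B_ℚ \ G_ℚ`. This file performs that step for the tree's datum
`AdelicGroupData.gl 2 K`, from the algebra of `GL2ParabolicClasses`:

* `GL2.mem_center_of_commute_unipotents`, `GL2.mem_center_iff_entries` — the centre of `GL₂(F)`
  over a field consists of the scalar matrices (commute with `1 + E₀₁` and `1 + E₁₀`);
  `GL2.map_mem_center_iff` — `γ ∈ GL₂(K)` is central in `GL₂(𝔸_K)` iff it is central in `GL₂(K)`.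
* `GL2.image_parabolic_eq` — **the parabolic set**: with `𝒞_ell` the set of elliptic regular
  classes (those represented by an element of irreducible characteristic polynomial),
  `(Γ ∖ S_{𝒞_ell}) ∖ (Γ ∩ Z) = ι(Par(K))`, `Par(K) = {γ ∈ GL₂(K) : γ ∉ Z, χ_γ reducible}`,
  `ι = (gl 2 K).toAdelic`.
* `GL2.conjTsum_parabolic_eq_tsum_quotient_borel` — **the parabolic kernel as a weighted sum over
  `GL₂(K) ⧸ B(K)`, `[0, ∞]`-valued**: for `F ≥ 0` on `GL₂(𝔸_K)` and every `x̃`,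
  `Σ'_{s ∈ ι(Par(K))} F(x̃ s x̃⁻¹) = Σ'_{q ∈ GL₂(K) ⧸ B(K)} Σ'_{β ∈ B(K) ∖ Z} w(β) F(x̃ ι(q̃ β q̃⁻¹) x̃⁻¹)`
  with `w = 1` on the non-semisimple and `w = ½` on the hyperbolic regular elements of `B(K)`
  (`GL2.tsum_parabolic_eq_tsum_quotient_borel`).
* `GL2.conjTsum_parabolic_eq_tsum_quotient_borel_complex` — the same for `F : GL₂(𝔸_K) → ℂ` when
  `Σ'_{s} ‖F(x̃ s x̃⁻¹)‖ < ∞` (which holds for `F = Ψ_A`, `GL2.summable_conj`), the weighted family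
  on `(GL₂(K) ⧸ B(K)) × (B(K) ∖ Z)` being then absolutely summable.

Writing `x̃ ι(q̃ β q̃⁻¹) x̃⁻¹ = (x̃ ι(q̃)) ι(β) (x̃ ι(q̃))⁻¹`, the inner sum is a function of `x̃ ι(q̃)`
invariant under right multiplication by `ι(B(K))` — the shape required by the (truncated)
unfolding over `B(K)` of Gelbart (9.40)–(9.45) / Jacquet–Langlands §16, which is NOT carried out
here. Part of the inline (D-0026) decomposition of
`Literature.NumberTheory.Automorphic.jacquetLanglands_transfer_exists`.

## References

* S. Gelbart, *Automorphic forms on adele groups*, Ann. of Math. Studies 83 (1975), (9.36)–(9.39)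
  [Gelbart1975].
* H. Jacquet, R. P. Langlands, *Automorphic forms on `GL(2)`*, LNM 114 (1970), §16
  [JacquetLanglands1970].
-/

noncomputable section

open NumberField IsDedekindDomain Matrix
open Literature.MeasureTheory.Group Literature.Topology.Algebra.InfiniteSum
open scoped NNReal ENNReal MatrixGroups

namespace Literature.NumberTheory.Automorphic

/-! ### The centre of `GL₂` -/

section Center

variable {F : Type*} [Field F]

/-- An element of `GL₂(F)` commuting with the unipotents `1 + E₀₁` and `1 + E₁₀` has
`γ₁₀ = γ₀₁ = 0` and `γ₀₀ = γ₁₁`. [folklore] -/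
theorem GL2.entries_of_commute_unipotents {γ : Matrix (Fin 2) (Fin 2) F}
    (h1 : γ * !![1, 1; 0, 1] = !![1, 1; 0, 1] * γ) (h2 : γ * !![1, 0; 1, 1] = !![1, 0; 1, 1] * γ) :
    γ 1 0 = 0 ∧ γ 0 1 = 0 ∧ γ 0 0 = γ 1 1 := by
  have e00 := congrFun (congrFun h1 0) 0
  have e01 := congrFun (congrFun h1 0) 1
  have f00 := congrFun (congrFun h2 0) 0
  simp only [Matrix.mul_apply, Fin.sum_univ_two] at e00 e01 f00
  simp at e00 e01 f00
  exact ⟨e00, f00, by linear_combination e01⟩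

/-- **The centre of `GL₂(F)` consists of the scalar matrices**: `γ ∈ Z ↔ γ₁₀ = γ₀₁ = 0 ∧ γ₀₀ = γ₁₁`.
[folklore] -/
theorem GL2.mem_center_iff_entries (γ : GL (Fin 2) F) :
    γ ∈ Subgroup.center (GL (Fin 2) F) ↔
      (γ : Matrix (Fin 2) (Fin 2) F) 1 0 = 0 ∧ (γ : Matrix (Fin 2) (Fin 2) F) 0 1 = 0 ∧
        (γ : Matrix (Fin 2) (Fin 2) F) 0 0 = (γ : Matrix (Fin 2) (Fin 2) F) 1 1 := by
  constructor
  · intro hc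
    have hu : Matrix.det (!![1, 1; 0, 1] : Matrix (Fin 2) (Fin 2) F) ≠ 0 := by
      rw [Matrix.det_fin_two_of]; simp
    have hl : Matrix.det (!![1, 0; 1, 1] : Matrix (Fin 2) (Fin 2) F) ≠ 0 := by
      rw [Matrix.det_fin_two_of]; simp
    have h1 := congrArg (fun g : GL (Fin 2) F => (g : Matrix (Fin 2) (Fin 2) F))
      ((Subgroup.mem_center_iff.1 hc) (Matrix.GeneralLinearGroup.mkOfDetNeZero _ hu))
    have h2 := congrArg (fun g : GL (Fin 2) F => (g : Matrix (Fin 2) (Fin 2) F))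
      ((Subgroup.mem_center_iff.1 hc) (Matrix.GeneralLinearGroup.mkOfDetNeZero _ hl))
    simp only [Units.val_mul] at h1 h2
    exact GL2.entries_of_commute_unipotents h1.symm h2.symm
  · rintro ⟨h10, h01, hdd⟩
    have hγ : (γ : Matrix (Fin 2) (Fin 2) F) = (γ : Matrix (Fin 2) (Fin 2) F) 0 0 • (1 : Matrix (Fin 2) (Fin 2) F) := by
      ext i j; fin_cases i <;> fin_cases j <;> simp [h10, h01, hdd]
    rw [Subgroup.mem_center_iff]
    intro g
    apply Units.ext
    rw [Units.val_mul, Units.val_mul, hγ, Matrix.mul_smul, Matrix.smul_mul, Matrix.mul_one,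
      Matrix.one_mul]

end Center

/-! ### Rational elements central in `GL₂(𝔸_K)` -/

section Adelic

variable (K : Type) [Field K] [NumberField K]

local notation "𝔸K" => AdeleRing (𝓞 K) K
local notation "M₂" => Matrix (Fin 2) (Fin 2) K
local notation "G₂" => AdelicGroupData.gl 2 K

/-- `GL₂(K) → GL₂(𝔸_K)` is injective. [folklore] -/
theorem GL2.map_algebraMap_injective :
    Function.Injective (Matrix.GeneralLinearGroup.map (n := Fin 2) (algebraMap K 𝔸K)) := by
  haveI : Nontrivial 𝔸K :=
    inferInstanceAs (Nontrivial (InfiniteAdeleRing K × FiniteAdeleRing (𝓞 K) K))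
  intro a b hab
  apply Units.ext
  have h := congrArg (fun g : GL (Fin 2) 𝔸K => (g : Matrix (Fin 2) (Fin 2) 𝔸K)) hab
  change (algebraMap K 𝔸K).mapMatrix (a : M₂) = (algebraMap K 𝔸K).mapMatrix (b : M₂) at h
  ext i j
  have hij := congrFun (congrFun h i) j
  simp only [RingHom.mapMatrix_apply, Matrix.map_apply] at hij
  exact (algebraMap K 𝔸K).injective hij

/-- **A rational element is central in `GL₂(𝔸_K)` iff it is central in `GL₂(K)`** (iff it is a
scalar). [folklore] -/
theorem GL2.map_mem_center_iff (γ : GL (Fin 2) K) :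
    Matrix.GeneralLinearGroup.map (algebraMap K 𝔸K) γ ∈ Subgroup.center (GL (Fin 2) 𝔸K) ↔
      γ ∈ Subgroup.center (GL (Fin 2) K) := by
  constructor
  · intro hc
    rw [GL2.mem_center_iff_entries]
    have hu : Matrix.det (!![1, 1; 0, 1] : M₂) ≠ 0 := by rw [Matrix.det_fin_two_of]; simp
    have hl : Matrix.det (!![1, 0; 1, 1] : M₂) ≠ 0 := by rw [Matrix.det_fin_two_of]; simp
    have key : ∀ u : GL (Fin 2) K, γ * u = u * γ := fun u =>
      GL2.map_algebraMap_injective K (by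
        rw [map_mul, map_mul]; exact ((Subgroup.mem_center_iff.1 hc) _).symm)
    have h1 := congrArg (fun g : GL (Fin 2) K => (g : M₂))
      (key (Matrix.GeneralLinearGroup.mkOfDetNeZero _ hu))
    have h2 := congrArg (fun g : GL (Fin 2) K => (g : M₂))
      (key (Matrix.GeneralLinearGroup.mkOfDetNeZero _ hl))
    simp only [Units.val_mul] at h1 h2
    exact GL2.entries_of_commute_unipotents h1 h2
  · intro hc
    obtain ⟨h10, h01, hdd⟩ := (GL2.mem_center_iff_entries γ).1 hc
    have hγ : ((Matrix.GeneralLinearGroup.map (algebraMap K 𝔸K) γ : GL (Fin 2) 𝔸K) :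
        Matrix (Fin 2) (Fin 2) 𝔸K) = algebraMap K 𝔸K ((γ : M₂) 0 0) • (1 : Matrix (Fin 2) (Fin 2) 𝔸K) := by
      change (algebraMap K 𝔸K).mapMatrix (γ : M₂) = _
      ext i j; fin_cases i <;> fin_cases j <;> simp [h10, h01, hdd]
    rw [Subgroup.mem_center_iff]
    intro g
    apply Units.ext
    rw [Units.val_mul, Units.val_mul, hγ, Matrix.mul_smul, Matrix.smul_mul, Matrix.mul_one,
      Matrix.one_mul]

/-! ### The parabolic set -/

/-- **The parabolic rational elements**: with `𝒞_ell` the set of classes of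
`Γ = GL₂(K) ≤ GL₂(𝔸_K)` represented by an element of irreducible characteristic polynomial, the
elements of `Γ` lying neither in an elliptic class nor in the centre are exactly the images of
`Par(K) = {γ ∈ GL₂(K) : γ ∉ Z(GL₂(K)), χ_γ reducible}`. [cite: Gelbart1975, (9.39)] -/
theorem GL2.image_parabolic_eq :
    ((((G₂).arithmeticSubgroup : Set (G₂).Adelic) \
        (((↑) : (G₂).arithmeticSubgroup → (G₂).Adelic) ''
          {γ : (G₂).arithmeticSubgroup | ConjClasses.mk γ ∈
            {c : ConjClasses (G₂).arithmeticSubgroup | ∃ g : GL (Fin 2) K,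
              Matrix.GeneralLinearGroup.map (algebraMap K 𝔸K) g =
                ((Quotient.out c : (G₂).arithmeticSubgroup) : (G₂).Adelic) ∧
              Irreducible (Matrix.charpoly (g : M₂))}})) \
        (((G₂).arithmeticSubgroup : Set (G₂).Adelic) ∩
          (Subgroup.center (G₂).Adelic : Set (G₂).Adelic))) =
      (fun γ : GL (Fin 2) K => ((G₂).toAdelic γ : (G₂).Adelic)) ''
        {γ : GL (Fin 2) K | γ ∉ Subgroup.center (GL (Fin 2) K) ∧
          ¬ Irreducible (Matrix.charpoly (γ : M₂))} := by
  set 𝒞 : Set (ConjClasses (G₂).arithmeticSubgroup) := {c | ∃ g : GL (Fin 2) K,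
    Matrix.GeneralLinearGroup.map (algebraMap K 𝔸K) g =
      ((Quotient.out c : (G₂).arithmeticSubgroup) : (G₂).Adelic) ∧
      Irreducible (Matrix.charpoly (g : M₂))} with h𝒞def
  have h𝒞 : ∀ c ∈ 𝒞, ∃ g : GL (Fin 2) K, Matrix.GeneralLinearGroup.map (algebraMap K 𝔸K) g =
      ((Quotient.out c : (G₂).arithmeticSubgroup) : (G₂).Adelic) ∧
      Irreducible (Matrix.charpoly (g : M₂)) := fun c hc => hc
  -- membership of a rational element in an elliptic class
  have hell : ∀ γ : GL (Fin 2) K, ConjClasses.mk (⟨(G₂).toAdelic γ, γ, rfl⟩ : (G₂).arithmeticSubgroup) ∈ 𝒞 ↔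
      Irreducible (Matrix.charpoly (γ : M₂)) := by
    intro γ
    constructor
    · intro h
      obtain ⟨g, hg, hirr⟩ := GL2.exists_eq_map_of_mk_mem K 𝒞 h𝒞 h
      have hgγ : g = γ := GL2.map_algebraMap_injective K hg
      rw [← hgγ]; exact hirr
    · intro hirr
      -- `out (mk γ) = δ γ δ⁻¹` with `δ` rational
      set c := ConjClasses.mk (⟨(G₂).toAdelic γ, γ, rfl⟩ : (G₂).arithmeticSubgroup) with hc
      have hrep : ConjClasses.mk (Quotient.out c : (G₂).arithmeticSubgroup) = c := by
        rw [← ConjClasses.quotient_mk_eq_mk]; exact Quotient.out_eq _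
      obtain ⟨δ, hδ⟩ := isConj_iff.1 (ConjClasses.mk_eq_mk_iff_isConj.1 (hrep.symm.trans rfl).symm)
      obtain ⟨d, hd⟩ : ∃ d : GL (Fin 2) K,
          Matrix.GeneralLinearGroup.map (algebraMap K 𝔸K) d = (δ : (G₂).Adelic) := δ.2
      refine ⟨d⁻¹ * γ * d, ?_, ?_⟩
      · have h0 := congrArg (fun x : (G₂).arithmeticSubgroup => (x : (G₂).Adelic)) hδ
        simp only [Subgroup.coe_mul, Subgroup.coe_inv] at h0
        have h1 : ((Quotient.out c : (G₂).arithmeticSubgroup) : (G₂).Adelic) =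
            (δ : (G₂).Adelic)⁻¹ * (G₂).toAdelic γ * δ := by
          rw [← h0]; group
        rw [h1, map_mul, map_mul, map_inv, hd]
        rfl
      · rw [Units.val_mul, Units.val_mul, Matrix.coe_units_inv, Matrix.charpoly_units_conj']
        exact hirr
  ext s
  simp only [Set.mem_sdiff, Set.mem_image, Set.mem_inter_iff, Set.mem_setOf_eq, SetLike.mem_coe]
  constructor
  · rintro ⟨⟨⟨γ, rfl⟩, hnotC⟩, hnotZ⟩
    refine ⟨γ, ⟨?_, ?_⟩, rfl⟩
    · intro hz
      apply hnotZ
      exact ⟨⟨γ, rfl⟩, (GL2.map_mem_center_iff K γ).2 hz⟩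
    · intro hirr
      apply hnotC
      exact ⟨⟨(G₂).toAdelic γ, γ, rfl⟩, (hell γ).2 hirr, rfl⟩
  · rintro ⟨γ, ⟨hz, hirr⟩, rfl⟩
    refine ⟨⟨⟨γ, rfl⟩, ?_⟩, ?_⟩
    · rintro ⟨γ', hγ', hγ's⟩
      have hγγ : γ' = ⟨(G₂).toAdelic γ, γ, rfl⟩ := Subtype.ext hγ's
      rw [hγγ] at hγ'
      exact hirr ((hell γ).1 hγ')
    · rintro ⟨-, hz'⟩
      exact hz ((GL2.map_mem_center_iff K γ).1 hz')

/-- **Conjugating a rational element by `ℓ ∈ L = A_G · GL₂(K)` is conjugating by a rational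
element**: `ℓ ι(γ) ℓ⁻¹ = ι(g₀ γ g₀⁻¹)` where `ℓ = ι(g₀) z` with `z` centralising `GL₂(K)`. [folklore] -/
theorem GL2.exists_conj_toAdelic_eq {ℓ : (G₂).Adelic} (hℓ : ℓ ∈ (G₂).quotientSubgroup)
    (γ : GL (Fin 2) K) :
    ∃ g₀ : GL (Fin 2) K, ℓ * (G₂).toAdelic γ * ℓ⁻¹ =
      (G₂).toAdelic g₀ * (G₂).toAdelic γ * ((G₂).toAdelic g₀)⁻¹ := by
  obtain ⟨γ₀, hγ₀, hcen⟩ :=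
    AdelicGroupData.exists_inv_mul_mem_centralizer_quotientSubgroup (G₂) ℓ hℓ
  obtain ⟨g₀, hg₀⟩ : ∃ g₀ : GL (Fin 2) K, (G₂).toAdelic g₀ = γ₀ := hγ₀
  have hmem : (G₂).toAdelic γ ∈ ((G₂).arithmeticSubgroup : Set (G₂).Adelic) := ⟨γ, rfl⟩
  have hcomm : (G₂).toAdelic γ * (γ₀⁻¹ * ℓ) = γ₀⁻¹ * ℓ * (G₂).toAdelic γ :=
    Subgroup.mem_centralizer_iff.1 hcen _ hmem
  refine ⟨g₀, ?_⟩
  rw [hg₀]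
  have hℓ' : ℓ = γ₀ * (γ₀⁻¹ * ℓ) := (mul_inv_cancel_left γ₀ ℓ).symm
  conv_lhs => rw [hℓ']
  rw [_root_.mul_inv_rev, mul_assoc γ₀ (γ₀⁻¹ * ℓ) ((G₂).toAdelic γ), ← hcomm,
    ← mul_assoc (γ₀ * ((G₂).toAdelic γ * (γ₀⁻¹ * ℓ))) (γ₀⁻¹ * ℓ)⁻¹ γ₀⁻¹,
    mul_assoc γ₀ ((G₂).toAdelic γ * (γ₀⁻¹ * ℓ)) (γ₀⁻¹ * ℓ)⁻¹, mul_inv_cancel_right]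

/-- **The image of the parabolic set is stable under conjugation by `L = A_G · GL₂(K)`**
(conjugates of parabolic elements by rational elements are parabolic). [folklore] -/
theorem GL2.conj_mem_image_parabolic :
    ∀ ℓ ∈ (G₂).quotientSubgroup, ∀ s ∈ (fun γ : GL (Fin 2) K => ((G₂).toAdelic γ : (G₂).Adelic)) ''
        {γ : GL (Fin 2) K | γ ∉ Subgroup.center (GL (Fin 2) K) ∧
          ¬ Irreducible (Matrix.charpoly (γ : M₂))},
      ℓ * s * ℓ⁻¹ ∈ (fun γ : GL (Fin 2) K => ((G₂).toAdelic γ : (G₂).Adelic)) ''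
        {γ : GL (Fin 2) K | γ ∉ Subgroup.center (GL (Fin 2) K) ∧
          ¬ Irreducible (Matrix.charpoly (γ : M₂))} := by
  rintro ℓ hℓ _ ⟨γ, ⟨hz, hirr⟩, rfl⟩
  obtain ⟨g₀, hg₀⟩ := GL2.exists_conj_toAdelic_eq K hℓ γ
  -- the diagonal embedding, typed `GL₂(K) →* (gl 2 K).Adelic`
  let ι : GL (Fin 2) K →* (G₂).Adelic := (G₂).toAdelic
  refine ⟨g₀ * γ * g₀⁻¹, ⟨GL2.conj_not_mem_center' hz, ?_⟩, ?_⟩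
  · rw [Units.val_mul, Units.val_mul, Matrix.coe_units_inv, Matrix.charpoly_units_conj]
    exact hirr
  · change ι (g₀ * γ * g₀⁻¹) = ℓ * ι γ * ℓ⁻¹
    rw [map_mul, map_mul, map_inv]
    exact hg₀.symm

/-- **The parabolic kernel as a weighted sum over `GL₂(K) ⧸ B(K)`, `[0, ∞]`-valued** (Gelbart
(1975), (9.36)–(9.38)): for `F : GL₂(𝔸_K) → [0, ∞]` and every `x̃`,

  `Σ'_{s ∈ ι(Par(K))} F(x̃ s x̃⁻¹) = Σ'_{q ∈ GL₂(K) ⧸ B(K)} Σ'_{β ∈ B(K) ∖ Z} w(β) F(x̃ ι(q̃ β q̃⁻¹) x̃⁻¹)`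

with `w(β) = 1` if `β₀₀ = β₁₁`, `½` otherwise (`GL2.tsum_parabolic_eq_tsum_quotient_borel` applied to
`γ ↦ F(x̃ ι(γ) x̃⁻¹)`). [cite: Gelbart1975, (9.36)–(9.38)] -/
theorem GL2.conjTsum_parabolic_eq_tsum_quotient_borel [DecidableEq K] (F : (G₂).Adelic → ℝ≥0∞)
    (x₀ : (G₂).Adelic) :
    conjTsum (G₂).quotientSubgroup ((fun γ : GL (Fin 2) K => ((G₂).toAdelic γ : (G₂).Adelic)) ''
        {γ : GL (Fin 2) K | γ ∉ Subgroup.center (GL (Fin 2) K) ∧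
          ¬ Irreducible (Matrix.charpoly (γ : M₂))}) (GL2.conj_mem_image_parabolic K) F
        (QuotientGroup.mk x₀) =
      ∑' q : GL (Fin 2) K ⧸ standardParabolicGL K (id : Fin 2 → Fin 2),
        ∑' β : {β : GL (Fin 2) K // β ∈ standardParabolicGL K (id : Fin 2 → Fin 2) ∧
            β ∉ Subgroup.center (GL (Fin 2) K)},
          (if ((β : GL (Fin 2) K) : M₂) 0 0 = ((β : GL (Fin 2) K) : M₂) 1 1 then 1 else 2⁻¹) *
            F (x₀ * (G₂).toAdelic (q.out * (β : GL (Fin 2) K) * q.out⁻¹) * x₀⁻¹) := by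
  rw [conjTsum_mk]
  have hinj : Function.Injective (fun γ : GL (Fin 2) K => ((G₂).toAdelic γ : (G₂).Adelic)) :=
    GL2.map_algebraMap_injective K
  rw [← (Equiv.Set.image (fun γ : GL (Fin 2) K => ((G₂).toAdelic γ : (G₂).Adelic))
    {γ : GL (Fin 2) K | γ ∉ Subgroup.center (GL (Fin 2) K) ∧
      ¬ Irreducible (Matrix.charpoly (γ : M₂))} hinj).tsum_eq]
  simp only [Equiv.Set.image_apply]
  exact GL2.tsum_parabolic_eq_tsum_quotient_borel (fun γ => F (x₀ * (G₂).toAdelic γ * x₀⁻¹))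

/-- **The parabolic kernel as a weighted sum over `GL₂(K) ⧸ B(K)`, complex-valued** (Gelbart
(1975), (9.36)–(9.38)): for `F : GL₂(𝔸_K) → ℂ` and `x̃` with `Σ'_{s ∈ ι(Par(K))} ‖F(x̃ s x̃⁻¹)‖ < ∞`
(e.g. `F = Ψ_A`, `GL2.summable_conj`), the inner families `β ↦ w(β) F(x̃ ι(q̃ β q̃⁻¹) x̃⁻¹)` on
`B(K) ∖ Z` and the outer family of their sums on `GL₂(K) ⧸ B(K)` are summable and

  `Σ_{s ∈ ι(Par(K))} F(x̃ s x̃⁻¹) = Σ'_{q ∈ GL₂(K) ⧸ B(K)} Σ'_{β ∈ B(K) ∖ Z} w(β) F(x̃ ι(q̃ β q̃⁻¹) x̃⁻¹)`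

(`tsum_eq_tsum_weighted_complex` applied to the `[0, ∞]` identity
`GL2.tsum_parabolic_eq_tsum_quotient_borel`). [cite: Gelbart1975, (9.36)–(9.38)] -/
theorem GL2.conjTsum_parabolic_eq_tsum_quotient_borel_complex [DecidableEq K]
    (F : (G₂).Adelic → ℂ) (x₀ : (G₂).Adelic)
    (hF : Summable fun s : ↥((fun γ : GL (Fin 2) K => ((G₂).toAdelic γ : (G₂).Adelic)) ''
        {γ : GL (Fin 2) K | γ ∉ Subgroup.center (GL (Fin 2) K) ∧
          ¬ Irreducible (Matrix.charpoly (γ : M₂))}) => ‖F (x₀ * s * x₀⁻¹)‖) :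
    (∀ q : GL (Fin 2) K ⧸ standardParabolicGL K (id : Fin 2 → Fin 2),
      Summable fun β : {β : GL (Fin 2) K // β ∈ standardParabolicGL K (id : Fin 2 → Fin 2) ∧
          β ∉ Subgroup.center (GL (Fin 2) K)} =>
        (((if ((β : GL (Fin 2) K) : M₂) 0 0 = ((β : GL (Fin 2) K) : M₂) 1 1 then (1 : ℝ≥0)
            else 2⁻¹ : ℝ≥0) : ℝ) : ℂ) *
          F (x₀ * (G₂).toAdelic (q.out * (β : GL (Fin 2) K) * q.out⁻¹) * x₀⁻¹)) ∧
    (Summable fun q : GL (Fin 2) K ⧸ standardParabolicGL K (id : Fin 2 → Fin 2) =>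
      ∑' β : {β : GL (Fin 2) K // β ∈ standardParabolicGL K (id : Fin 2 → Fin 2) ∧
          β ∉ Subgroup.center (GL (Fin 2) K)},
        (((if ((β : GL (Fin 2) K) : M₂) 0 0 = ((β : GL (Fin 2) K) : M₂) 1 1 then (1 : ℝ≥0)
            else 2⁻¹ : ℝ≥0) : ℝ) : ℂ) *
          F (x₀ * (G₂).toAdelic (q.out * (β : GL (Fin 2) K) * q.out⁻¹) * x₀⁻¹)) ∧
    conjTsum (G₂).quotientSubgroup ((fun γ : GL (Fin 2) K => ((G₂).toAdelic γ : (G₂).Adelic)) ''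
        {γ : GL (Fin 2) K | γ ∉ Subgroup.center (GL (Fin 2) K) ∧
          ¬ Irreducible (Matrix.charpoly (γ : M₂))}) (GL2.conj_mem_image_parabolic K) F
        (QuotientGroup.mk x₀) =
      ∑' q : GL (Fin 2) K ⧸ standardParabolicGL K (id : Fin 2 → Fin 2),
        ∑' β : {β : GL (Fin 2) K // β ∈ standardParabolicGL K (id : Fin 2 → Fin 2) ∧
            β ∉ Subgroup.center (GL (Fin 2) K)},
          (((if ((β : GL (Fin 2) K) : M₂) 0 0 = ((β : GL (Fin 2) K) : M₂) 1 1 then (1 : ℝ≥0)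
              else 2⁻¹ : ℝ≥0) : ℝ) : ℂ) *
            F (x₀ * (G₂).toAdelic (q.out * (β : GL (Fin 2) K) * q.out⁻¹) * x₀⁻¹) := by
  -- `X = ι(Par)`, `π (q, β) = ι(q̃ β q̃⁻¹) ∈ X`
  have hmem : ∀ (q : GL (Fin 2) K ⧸ standardParabolicGL K (id : Fin 2 → Fin 2))
      (β : {β : GL (Fin 2) K // β ∈ standardParabolicGL K (id : Fin 2 → Fin 2) ∧
        β ∉ Subgroup.center (GL (Fin 2) K)}),
      ((G₂).toAdelic (q.out * (β : GL (Fin 2) K) * q.out⁻¹) : (G₂).Adelic) ∈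
        (fun γ : GL (Fin 2) K => ((G₂).toAdelic γ : (G₂).Adelic)) ''
          {γ : GL (Fin 2) K | γ ∉ Subgroup.center (GL (Fin 2) K) ∧
            ¬ Irreducible (Matrix.charpoly (γ : M₂))} := fun q β =>
    ⟨q.out * (β : GL (Fin 2) K) * q.out⁻¹, ⟨GL2.conj_not_mem_center' β.2.2,
      GL2.not_irreducible_charpoly_conj_of_mem_borel q.out β.2.1⟩, rfl⟩
  -- the `[0, ∞]` identity for all `g` on `X`, from the case `x̃ = 1`
  have H : ∀ g : ↥((fun γ : GL (Fin 2) K => ((G₂).toAdelic γ : (G₂).Adelic)) ''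
      {γ : GL (Fin 2) K | γ ∉ Subgroup.center (GL (Fin 2) K) ∧
        ¬ Irreducible (Matrix.charpoly (γ : M₂))}) → ℝ≥0∞,
      ∑' s, g s = ∑' q : GL (Fin 2) K ⧸ standardParabolicGL K (id : Fin 2 → Fin 2),
        ∑' β : {β : GL (Fin 2) K // β ∈ standardParabolicGL K (id : Fin 2 → Fin 2) ∧
            β ∉ Subgroup.center (GL (Fin 2) K)},
          ((if ((β : GL (Fin 2) K) : M₂) 0 0 = ((β : GL (Fin 2) K) : M₂) 1 1 then (1 : ℝ≥0)
              else 2⁻¹ : ℝ≥0) : ℝ≥0∞) * g ⟨_, hmem q β⟩ := by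
    intro g
    classical
    have h1 := GL2.conjTsum_parabolic_eq_tsum_quotient_borel K
      (fun y => if h : y ∈ (fun γ : GL (Fin 2) K => ((G₂).toAdelic γ : (G₂).Adelic)) ''
          {γ : GL (Fin 2) K | γ ∉ Subgroup.center (GL (Fin 2) K) ∧
            ¬ Irreducible (Matrix.charpoly (γ : M₂))} then g ⟨y, h⟩ else 0) 1
    rw [conjTsum_mk] at h1
    simp only [one_mul, inv_one, mul_one] at h1
    rw [show (∑' s : ↥((fun γ : GL (Fin 2) K => ((G₂).toAdelic γ : (G₂).Adelic)) ''
        {γ : GL (Fin 2) K | γ ∉ Subgroup.center (GL (Fin 2) K) ∧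
          ¬ Irreducible (Matrix.charpoly (γ : M₂))}), g s) =
        ∑' s : ↥((fun γ : GL (Fin 2) K => ((G₂).toAdelic γ : (G₂).Adelic)) ''
          {γ : GL (Fin 2) K | γ ∉ Subgroup.center (GL (Fin 2) K) ∧
            ¬ Irreducible (Matrix.charpoly (γ : M₂))}),
          (if h : (s : (G₂).Adelic) ∈ (fun γ : GL (Fin 2) K => ((G₂).toAdelic γ : (G₂).Adelic)) ''
              {γ : GL (Fin 2) K | γ ∉ Subgroup.center (GL (Fin 2) K) ∧
                ¬ Irreducible (Matrix.charpoly (γ : M₂))} then g ⟨s, h⟩ else 0)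
        from tsum_congr fun s => by rw [dif_pos s.2]]
    rw [h1]
    refine tsum_congr fun q => tsum_congr fun β => ?_
    rw [dif_pos (hmem q β)]
    congr 1
    split_ifs <;> simp
  obtain ⟨h1, h2, h3⟩ := tsum_eq_tsum_weighted_complex (fun q β => (⟨_, hmem q β⟩ :
      ↥((fun γ : GL (Fin 2) K => ((G₂).toAdelic γ : (G₂).Adelic)) ''
        {γ : GL (Fin 2) K | γ ∉ Subgroup.center (GL (Fin 2) K) ∧
          ¬ Irreducible (Matrix.charpoly (γ : M₂))})))
    (fun β : {β : GL (Fin 2) K // β ∈ standardParabolicGL K (id : Fin 2 → Fin 2) ∧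
        β ∉ Subgroup.center (GL (Fin 2) K)} =>
      (if ((β : GL (Fin 2) K) : M₂) 0 0 = ((β : GL (Fin 2) K) : M₂) 1 1 then (1 : ℝ≥0) else 2⁻¹))
    H (fun s => F (x₀ * s * x₀⁻¹)) hF
  refine ⟨h1, h2, ?_⟩
  rw [conjTsum_mk]
  exact h3

end Adelic

end Literature.NumberTheory.Automorphic
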